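import Literature.NumberTheory.EllipticCurves.WeilPairingLevelDescent
import Literature.NumberTheory.EllipticCurves.WeilPairingLevelCompatProofs
import Literature.NumberTheory.GaloisRepresentations.LocalKummerTorsion
import Literature.NumberTheory.GaloisRepresentations.ContinuousShapiroLiftCupAdjoint
import Literature.NumberTheory.GaloisCohomology.LocalInvariantMapLevelChange
import HarnessLib

/-!
# Level transport of the Shapiro cup classes of the Weil pairing: `c_n = (ι_μ)_* c_d`

Topic `NumberTheory/EllipticCurves`; namespace `Literature.NumberTheory.EllipticCurves` (as
`WeilPairingLevelDescent.lean`, `KummerImageIsotropy.lean`). Theorems only: **no definition and no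
named fact is introduced** (D-0026).

Two levels `d ∣ n`, two `Γ_F`-equivariant biadditive pairings `e₁ : E[d] × E[d] → μ_d`,
`e₂ : E[n] × E[n] → μ_n` (packaged by the tree's `weilContPairing`), level maps `α : E[n] → E[d]`
("multiplication by `n/d`") and `β : E[d] → E[n]` (the inclusion), COMPATIBLE in the sense of
Silverman *AEC* III.8.1 (e):  `e₂(S', β T) = e₁(α S', T)` in `F̄` (hypothesis `hcompat`; discharged for
the tree's constructed pairings `weilPairingFun` in `weilPairingFun_levelCompat`, from the tree's
`WeierstrassCurve.weilPairingFun_mul`).  For an open finite-index subgroup `N ≤ Γ_F` (a layer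
`Γ_{F_N}`), layer classes `a ∈ H¹(N, E[n])`, `b ∈ H¹(N, E[d])`, and the SHAPIRO CUP CLASSES
(`shapiroLift`, summed pairing `ContPairing.coindFin`)

  `c_d := Sh_N(α_* a) ∪_{Σ e₁} Sh_N b ∈ H²(Γ_F, μ_d)`,  `c_n := Sh_N a ∪_{Σ e₂} Sh_N(β_* b) ∈ H²(Γ_F, μ_n)`:

* `weilContPairing_toLin_levelCompat` — the coefficient identity `ι_μ e₁(α x, y) = e₂(x, β y)` in `μ_n`;
* **`shapiroLift_cupProduct_weil_levelTransport`** — `(ι_μ)_* c_d = c_n` (`ι_μ = muInclHom F (d ∣ n)`),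
  an instance of the generic `shapiroLift_cupProduct_coindFin_map_adjoint`;
* **`localInvariantMap_shapiroCup_levelTransport_eq_zero_iff`** — over a number field `K`, at a finite
  place `v`: `inv_v^{(n)}(loc_v c_n) = 0 ↔ inv_v^{(d)}(loc_v c_d) = 0` (with the tree's level change of
  the local invariants, `localInvariantMap_localization_muInclHom_eq_zero_iff`, Serre *CL* XIII §3);
* `weilPairingFun_levelCompat` — `hcompat` for `e₁ = e_d`, `e₂ = e_n` the tree's Weil pairing functions
  and ANY level maps `α`, `β` acting on points as `S' ↦ (n/d) S'`, `T ↦ T`.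

Consumer: crux K3 of `Summits/BirchSwinnertonDyer` ((PT-orth), step [S2-B3] «`c_{K'} = (ι_μ)_* c_K`,
hence `inv_v^{(K)}(loc c_K) = 0 ↔ inv_v^{(K')}(loc c_{K'}) = 0`», levels `d = 2^K ∣ n = 2^{K'}`,
`a_K = 2^{K'-K} a_{K'}`, `b_{K'} = ι b_K`).

## References
* [SilvermanAEC2009] J. H. Silverman, *The Arithmetic of Elliptic Curves*, 2nd ed. (2009), Prop. III.8.1 (e).
* [NeukirchSchmidtWingberg2008] J. Neukirch, A. Schmidt, K. Wingberg, *Cohomology of Number Fields* (2008),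
  I §4 (1.4.2), I §6 (1.6.4).
* [SerreLocalFields1979] J.-P. Serre, *Local Fields* (1979), XIII §3 Cor. 3.
-/

noncomputable section

open scoped Classical

universe u

namespace Literature.NumberTheory.EllipticCurves

open CategoryTheory Field _root_.WeierstrassCurve
open _root_.TopRep _root_.ContinuousCohomology
open Literature.NumberTheory.GaloisRepresentations
open Literature.NumberTheory.GaloisRepresentations.DiscreteGaloisModule (mu MuCarrier pairing)
open scoped ContRepresentation

-- Cup products need `LocallyCompactSpace Γ_F`: the compactness of the absolute Galois group (the tree's
-- `absoluteGaloisGroup_compactSpace`, a local instance in the consumer files) is taken as an instance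
-- HYPOTHESIS `[CompactSpace (absoluteGaloisGroup F)]` (a `Prop`, so any two witnesses agree).

section Transport

variable {F : Type u} [Field F] (W : WeierstrassCurve F) (d n : ℕ) [NeZero d] [NeZero n] (hdn : d ∣ n)
variable (e₁ : geomTorsion W (d : ℤ) → geomTorsion W (d : ℤ) → AlgebraicClosure F)
  (hμ₁ : ∀ S T, e₁ S T ^ d = 1)
  (hadd₁₁ : ∀ S₁ S₂ T, e₁ (S₁ + S₂) T = e₁ S₁ T * e₁ S₂ T)
  (hadd₁₂ : ∀ S T₁ T₂, e₁ S (T₁ + T₂) = e₁ S T₁ * e₁ S T₂)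
  (hgal₁ : ∀ (σ : absoluteGaloisGroup F) (S T : geomTorsion W (d : ℤ)), σ • e₁ S T = e₁ (σ • S) (σ • T))
variable (e₂ : geomTorsion W (n : ℤ) → geomTorsion W (n : ℤ) → AlgebraicClosure F)
  (hμ₂ : ∀ S T, e₂ S T ^ n = 1)
  (hadd₂₁ : ∀ S₁ S₂ T, e₂ (S₁ + S₂) T = e₂ S₁ T * e₂ S₂ T)
  (hadd₂₂ : ∀ S T₁ T₂, e₂ S (T₁ + T₂) = e₂ S T₁ * e₂ S T₂)
  (hgal₂ : ∀ (σ : absoluteGaloisGroup F) (S T : geomTorsion W (n : ℤ)), σ • e₂ S T = e₂ (σ • S) (σ • T))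
variable (α : (W.torsionGaloisModule (n : ℤ)).toContRepresentation →ⁱL (W.torsionGaloisModule (d : ℤ)).toContRepresentation)
  (β : (W.torsionGaloisModule (d : ℤ)).toContRepresentation →ⁱL (W.torsionGaloisModule (n : ℤ)).toContRepresentation)
  (hcompat : ∀ (S' : geomTorsion W (n : ℤ)) (T : geomTorsion W (d : ℤ)), e₂ S' (β T) = e₁ (α S') T)

include hcompat in
/-- **The coefficient identity** `ι_μ e₁(α x, y) = e₂(x, β y)` in `μ_n(F̄)`, for compatible pairings
(`e₂(S', β T) = e₁(α S', T)` in `F̄`). [cite: SilvermanAEC2009, Prop. III.8.1(e)] -/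
theorem weilContPairing_toLin_levelCompat (x : geomTorsion W (n : ℤ)) (y : geomTorsion W (d : ℤ)) :
    (muInclHom F hdn).hom ((weilContPairing W d e₁ hμ₁ hadd₁₁ hadd₁₂ hgal₁).toLin
        ((DiscreteGaloisModule.homOfIntertwining α).hom x) y) =
      (weilContPairing W n e₂ hμ₂ hadd₂₁ hadd₂₂ hgal₂).toLin x
        ((DiscreteGaloisModule.homOfIntertwining β).hom y) := by
  apply muVal_injective F n
  rw [muInclHom_hom_apply, muVal_muInclusion]
  apply Units.ext
  exact (hcompat x y).symm

variable [CompactSpace (absoluteGaloisGroup F)] (N : Subgroup (absoluteGaloisGroup F))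
  [Fintype (absoluteGaloisGroup F ⧸ N)]
  (hN : IsOpen (N : Set (absoluteGaloisGroup F))) {s : absoluteGaloisGroup F ⧸ N → absoluteGaloisGroup F}
  (hs : ∀ x : absoluteGaloisGroup F ⧸ N, (s x : absoluteGaloisGroup F ⧸ N) = x)
  (hs1 : s ((1 : absoluteGaloisGroup F) : absoluteGaloisGroup F ⧸ N) = 1)

include hcompat in
/-- **Level transport of the Shapiro cup classes of the Weil pairing, `(ι_μ)_* c_d = c_n`.**
For `d ∣ n`, compatible pairings `e₁` (level `d`), `e₂` (level `n`) and level maps `α : E[n] → E[d]`,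
`β : E[d] → E[n]` (`e₂(S', β T) = e₁(α S', T)`), a layer `N ≤ Γ_F` (open, finite index, coset
representatives `s`) and layer classes `a ∈ H¹(N, E[n])`, `b ∈ H¹(N, E[d])`:
`(ι_μ)_* ( Sh_N(α_* a) ∪_{Σ e₁} Sh_N b ) = Sh_N a ∪_{Σ e₂} Sh_N(β_* b)` in `H²(Γ_F, μ_n)`.
[cite: NeukirchSchmidtWingberg2008, I §4 (1.4.2)] [cite: SilvermanAEC2009, Prop. III.8.1(e)] -/
theorem shapiroLift_cupProduct_weil_levelTransport
    (a : continuousCohomology 1 (subgroupRep (W.torsionGaloisModule (n : ℤ)).toTopRep N))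
    (b : continuousCohomology 1 (subgroupRep (W.torsionGaloisModule (d : ℤ)).toTopRep N)) :
    cohomologyMap (muInclHom F hdn) 2
        (((weilContPairing W d e₁ hμ₁ hadd₁₁ hadd₁₂ hgal₁).coindFin N).cupProduct
          (shapiroLift (W.torsionGaloisModule (d : ℤ)).toTopRep N hN hs hs1
            (cohomologyMap (subgroupRepMap (DiscreteGaloisModule.homOfIntertwining α) N) 1 a))
          (shapiroLift (W.torsionGaloisModule (d : ℤ)).toTopRep N hN hs hs1 b)) =
      ((weilContPairing W n e₂ hμ₂ hadd₂₁ hadd₂₂ hgal₂).coindFin N).cupProduct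
        (shapiroLift (W.torsionGaloisModule (n : ℤ)).toTopRep N hN hs hs1 a)
        (shapiroLift (W.torsionGaloisModule (n : ℤ)).toTopRep N hN hs hs1
          (cohomologyMap (subgroupRepMap (DiscreteGaloisModule.homOfIntertwining β) N) 1 b)) :=
  shapiroLift_cupProduct_coindFin_map_adjoint _ _ (DiscreteGaloisModule.homOfIntertwining α)
    (DiscreteGaloisModule.homOfIntertwining β) (muInclHom F hdn) N hN hs hs1
    (weilContPairing_toLin_levelCompat W d n hdn e₁ hμ₁ hadd₁₁ hadd₁₂ hgal₁ e₂ hμ₂ hadd₂₁ hadd₂₂ hgal₂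
      α β hcompat) a b

end Transport

section NumberField

open NumberField IsDedekindDomain Literature.NumberTheory.GaloisCohomology

variable {K : Type u} [Field K] [NumberField K] (W : WeierstrassCurve K) (d n : ℕ) [NeZero d] [NeZero n]
  (hdn : d ∣ n)
variable (e₁ : geomTorsion W (d : ℤ) → geomTorsion W (d : ℤ) → AlgebraicClosure K)
  (hμ₁ : ∀ S T, e₁ S T ^ d = 1)
  (hadd₁₁ : ∀ S₁ S₂ T, e₁ (S₁ + S₂) T = e₁ S₁ T * e₁ S₂ T)
  (hadd₁₂ : ∀ S T₁ T₂, e₁ S (T₁ + T₂) = e₁ S T₁ * e₁ S T₂)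
  (hgal₁ : ∀ (σ : absoluteGaloisGroup K) (S T : geomTorsion W (d : ℤ)), σ • e₁ S T = e₁ (σ • S) (σ • T))
variable (e₂ : geomTorsion W (n : ℤ) → geomTorsion W (n : ℤ) → AlgebraicClosure K)
  (hμ₂ : ∀ S T, e₂ S T ^ n = 1)
  (hadd₂₁ : ∀ S₁ S₂ T, e₂ (S₁ + S₂) T = e₂ S₁ T * e₂ S₂ T)
  (hadd₂₂ : ∀ S T₁ T₂, e₂ S (T₁ + T₂) = e₂ S T₁ * e₂ S T₂)
  (hgal₂ : ∀ (σ : absoluteGaloisGroup K) (S T : geomTorsion W (n : ℤ)), σ • e₂ S T = e₂ (σ • S) (σ • T))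
variable (α : (W.torsionGaloisModule (n : ℤ)).toContRepresentation →ⁱL (W.torsionGaloisModule (d : ℤ)).toContRepresentation)
  (β : (W.torsionGaloisModule (d : ℤ)).toContRepresentation →ⁱL (W.torsionGaloisModule (n : ℤ)).toContRepresentation)
  (hcompat : ∀ (S' : geomTorsion W (n : ℤ)) (T : geomTorsion W (d : ℤ)), e₂ S' (β T) = e₁ (α S') T)
variable [CompactSpace (absoluteGaloisGroup K)] (N : Subgroup (absoluteGaloisGroup K))
  [Fintype (absoluteGaloisGroup K ⧸ N)]
  (hN : IsOpen (N : Set (absoluteGaloisGroup K))) {s : absoluteGaloisGroup K ⧸ N → absoluteGaloisGroup K}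
  (hs : ∀ x : absoluteGaloisGroup K ⧸ N, (s x : absoluteGaloisGroup K ⧸ N) = x)
  (hs1 : s ((1 : absoluteGaloisGroup K) : absoluteGaloisGroup K ⧸ N) = 1)
  (v : HeightOneSpectrum (𝓞 K))

include hdn hcompat in
/-- **The vanishing of the local invariant of a Shapiro cup class is insensitive to the level.**
Over a number field `K`, at a finite place `v`, for `d ∣ n`, compatible pairings and level maps as in
`shapiroLift_cupProduct_weil_levelTransport`, and layer classes `a ∈ H¹(N, E[n])`, `b ∈ H¹(N, E[d])`:
`inv_v^{(n)}(loc_v (Sh_N a ∪_{Σ e₂} Sh_N(β_* b))) = 0 ↔ inv_v^{(d)}(loc_v (Sh_N(α_* a) ∪_{Σ e₁} Sh_N b)) = 0`.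
(`c_n = (ι_μ)_* c_d` and the level compatibility of THE local invariant maps.)
[cite: SerreLocalFields1979, XIII §3 Cor. 3] [cite: SilvermanAEC2009, Prop. III.8.1(e)] -/
theorem localInvariantMap_shapiroCup_levelTransport_eq_zero_iff
    (a : continuousCohomology 1 (subgroupRep (W.torsionGaloisModule (n : ℤ)).toTopRep N))
    (b : continuousCohomology 1 (subgroupRep (W.torsionGaloisModule (d : ℤ)).toTopRep N)) :
    localInvariantMap K n v (galoisCohomology.localization (mu K n) (Sum.inr v) 2
        (((weilContPairing W n e₂ hμ₂ hadd₂₁ hadd₂₂ hgal₂).coindFin N).cupProduct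
          (shapiroLift (W.torsionGaloisModule (n : ℤ)).toTopRep N hN hs hs1 a)
          (shapiroLift (W.torsionGaloisModule (n : ℤ)).toTopRep N hN hs hs1
            (cohomologyMap (subgroupRepMap (DiscreteGaloisModule.homOfIntertwining β) N) 1 b)))) = 0 ↔
      localInvariantMap K d v (galoisCohomology.localization (mu K d) (Sum.inr v) 2
        (((weilContPairing W d e₁ hμ₁ hadd₁₁ hadd₁₂ hgal₁).coindFin N).cupProduct
          (shapiroLift (W.torsionGaloisModule (d : ℤ)).toTopRep N hN hs hs1
            (cohomologyMap (subgroupRepMap (DiscreteGaloisModule.homOfIntertwining α) N) 1 a))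
          (shapiroLift (W.torsionGaloisModule (d : ℤ)).toTopRep N hN hs hs1 b))) = 0 := by
  rw [← shapiroLift_cupProduct_weil_levelTransport W d n hdn e₁ hμ₁ hadd₁₁ hadd₁₂ hgal₁ e₂ hμ₂ hadd₂₁
    hadd₂₂ hgal₂ α β hcompat N hN hs hs1 a b]
  exact localInvariantMap_localization_muInclHom_eq_zero_iff hdn v _

end NumberField

/-! ## The compatibility hypothesis for the tree's Weil pairing functions -/

section WeilPairingFun

variable {F : Type u} [Field F] (W : WeierstrassCurve F) [W.IsElliptic] {d n : ℕ} (hdn : d ∣ n)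
  (hd : (d : F) ≠ 0) (hn : (n : F) ≠ 0)

/-- `weilPairingFun` only depends on the level through the proposition `(m : F) ≠ 0`: equal levels
give equal pairing functions (Silverman's `e_m` is indexed by the integer `m` only).
[cite: SilvermanAEC2009, III.§8 (definition of e_m)] -/
theorem weilPairingFun_congr_level {m₁ m₂ : ℕ} (h : m₁ = m₂) (h₁ : (m₁ : F) ≠ 0) (h₂ : (m₂ : F) ≠ 0)
    (S T : W.geomPoints) : weilPairingFun h₁ S T = weilPairingFun h₂ S T := by
  subst h
  rfl

include hdn in
/-- **Silverman III.8.1 (e) for the tree's Weil pairing functions, in level-map form**: for `d ∣ n`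
(`n ≠ 0` in `F`) and ANY maps `α : E[n] → E[d]`, `β : E[d] → E[n]` acting on points as
`S' ↦ (n/d) • S'` and `T ↦ T`, `e_n(S', β T) = e_d(α S', T)` — the hypothesis `hcompat` of
`shapiroLift_cupProduct_weil_levelTransport` for `e₁ = e_d`, `e₂ = e_n`.
[cite: SilvermanAEC2009, Prop. III.8.1(e)] -/
theorem weilPairingFun_levelCompat
    (α : geomTorsion W (n : ℤ) → geomTorsion W (d : ℤ)) (β : geomTorsion W (d : ℤ) → geomTorsion W (n : ℤ))
    (hα : ∀ S' : geomTorsion W (n : ℤ), ((α S' : geomTorsion W (d : ℤ)) : W.geomPoints) = ((n / d : ℕ) : ℤ) • (S' : W.geomPoints))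
    (hβ : ∀ T : geomTorsion W (d : ℤ), ((β T : geomTorsion W (n : ℤ)) : W.geomPoints) = (T : W.geomPoints))
    (S' : geomTorsion W (n : ℤ)) (T : geomTorsion W (d : ℤ)) :
    weilPairingFun hn (S' : W.geomPoints) ((β T : geomTorsion W (n : ℤ)) : W.geomPoints) =
      weilPairingFun hd ((α S' : geomTorsion W (d : ℤ)) : W.geomPoints) (T : W.geomPoints) := by
  have hlev : d * (n / d) = n := Nat.mul_div_cancel' hdn
  have hdq : ((d * (n / d) : ℕ) : F) ≠ 0 := by rwa [hlev]
  have hS : ((d * (n / d) : ℕ) : ℤ) • (S' : W.geomPoints) = 0 := by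
    rw [hlev]; exact (mem_geomTorsion_iff W (n : ℤ) _).1 S'.2
  have hT : (d : ℤ) • (T : W.geomPoints) = 0 := (mem_geomTorsion_iff W (d : ℤ) _).1 T.2
  rw [hβ, hα, weilPairingFun_congr_level W hlev.symm hn hdq, weilPairingFun_mul hd hdq hS hT]

end WeilPairingFun

/-! ## The tower compatibility from the one-step compatibility

The research stubs of `Summits/BirchSwinnertonDyer` (crux K3, `stub_ptOrthLayerTwo`) carry a compatible Weil FAMILY
`e k : E[p^k] × E[p^k] → μ_{p^k}` with the ONE-STEP compatibility «`e (k+1) S' T' = e k S T` whenever `S = p • S'`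
and `T' = T` on points» (Silverman III.8.1 (e) with `m' = p`).  Iterating gives the `(L − L₀)`-step compatibility in
the level-map form `hcompat` used by the transport theorems above. -/

section OneStep

variable {F : Type u} [Field F] (W : WeierstrassCurve F) {p : ℕ}
  (e : ∀ k : ℕ, geomTorsion W ((p ^ k : ℕ) : ℤ) → geomTorsion W ((p ^ k : ℕ) : ℤ) → AlgebraicClosure F)
  (hstep : ∀ (k : ℕ) (S' : geomTorsion W ((p ^ (k + 1) : ℕ) : ℤ)) (S : geomTorsion W ((p ^ k : ℕ) : ℤ))
    (T' : geomTorsion W ((p ^ (k + 1) : ℕ) : ℤ)) (T : geomTorsion W ((p ^ k : ℕ) : ℤ)),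
    (S : W.geomPoints) = (p : ℤ) • (S' : W.geomPoints) → (T' : W.geomPoints) = (T : W.geomPoints) →
    e (k + 1) S' T' = e k S T)

include hstep in
/-- **`j`-step compatibility from the one-step compatibility, on points**: if `e (k+1) S' T' = e k S T` whenever
`S = p S'`, `T' = T` in `E(F̄)`, then `e (L₀ + j) S' T' = e L₀ S₀ T` whenever `S₀ = p^j S'` and `T' = T` in `E(F̄)`.
[cite: SilvermanAEC2009, Prop. III.8.1(e)] -/
theorem weilFamily_compat_add (L₀ j : ℕ) (S' : geomTorsion W ((p ^ (L₀ + j) : ℕ) : ℤ))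
    (T' : geomTorsion W ((p ^ (L₀ + j) : ℕ) : ℤ)) (S₀ T : geomTorsion W ((p ^ L₀ : ℕ) : ℤ))
    (hS : (S₀ : W.geomPoints) = (p : ℤ) ^ j • (S' : W.geomPoints)) (hT : (T' : W.geomPoints) = (T : W.geomPoints)) :
    e (L₀ + j) S' T' = e L₀ S₀ T := by
  induction j with
  | zero =>
    rw [pow_zero, one_smul] at hS
    have h1 : S₀ = S' := Subtype.ext hS
    have h2 : T = T' := Subtype.ext hT.symm
    subst h1 h2
    rfl
  | succ j ih =>
    -- the intermediate points at level `p^(L₀+j)`: `S₁ = p • S'`, `T₁ = T`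
    have hS₁ : (p : ℤ) • (S' : W.geomPoints) ∈ geomTorsion W ((p ^ (L₀ + j) : ℕ) : ℤ) := by
      rw [mem_geomTorsion_iff, smul_smul]
      have h := (W.mem_geomTorsion_iff ((p ^ (L₀ + j + 1) : ℕ) : ℤ) _).1 S'.2
      rwa [pow_succ, Nat.cast_mul] at h
    have hT₁ : (T : W.geomPoints) ∈ geomTorsion W ((p ^ (L₀ + j) : ℕ) : ℤ) :=
      W.geomTorsion_le_of_dvd (Int.natCast_dvd_natCast.mpr (pow_dvd_pow p (Nat.le_add_right L₀ j))) T.2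
    have h1 : e (L₀ + j + 1) S' T' = e (L₀ + j) ⟨_, hS₁⟩ ⟨_, hT₁⟩ := hstep (L₀ + j) S' ⟨_, hS₁⟩ T' ⟨_, hT₁⟩ rfl hT
    have h2 : e (L₀ + j) ⟨_, hS₁⟩ ⟨_, hT₁⟩ = e L₀ S₀ T :=
      ih ⟨_, hS₁⟩ ⟨_, hT₁⟩ (by rw [hS, pow_succ, mul_smul]) rfl
    exact h1.trans h2

include hstep in
/-- **The hypothesis `hcompat` of `shapiroCup_weil_htrans` from the one-step compatibility**: for `L₀ ≤ L` and ANY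
level maps `α : E[p^L] → E[p^{L₀}]` (`S ↦ p^{L−L₀} S` on points), `β : E[p^{L₀}] → E[p^L]` (`T ↦ T` on points),
`e L S' (β T) = e L₀ (α S') T`. [cite: SilvermanAEC2009, Prop. III.8.1(e)] -/
theorem weilFamily_hcompat_of_step (L₀ L : ℕ) (hL : L₀ ≤ L)
    (α : (W.torsionGaloisModule ((p ^ L : ℕ) : ℤ)).toContRepresentation →ⁱL
      (W.torsionGaloisModule ((p ^ L₀ : ℕ) : ℤ)).toContRepresentation)
    (β : (W.torsionGaloisModule ((p ^ L₀ : ℕ) : ℤ)).toContRepresentation →ⁱL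
      (W.torsionGaloisModule ((p ^ L : ℕ) : ℤ)).toContRepresentation)
    (hα : ∀ S, ((α S : geomTorsion W ((p ^ L₀ : ℕ) : ℤ)) : W.geomPoints) = (p : ℤ) ^ (L - L₀) • (S : W.geomPoints))
    (hβ : ∀ T, ((β T : geomTorsion W ((p ^ L : ℕ) : ℤ)) : W.geomPoints) = (T : W.geomPoints))
    (S' : geomTorsion W ((p ^ L : ℕ) : ℤ)) (T : geomTorsion W ((p ^ L₀ : ℕ) : ℤ)) :
    e L S' (β T) = e L₀ (α S') T := by
  obtain ⟨j, rfl⟩ := Nat.exists_eq_add_of_le hL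
  rw [Nat.add_sub_cancel_left] at hα
  exact weilFamily_compat_add W e hstep L₀ j S' (β T) (α S') T (hα S') (hβ T)

end OneStep

end Literature.NumberTheory.EllipticCurves
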